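import Summits.CriticalPhenomena.PercolationContinuityZ3.Theorems.PercNearOneGluingNoHeavyLowerTailSahiCombTriWShell

/-!
# `TRI_W(a) ≥ 0` on every cell when one member is a RECTANGLE `u(y) ∧ v(z)` (every index cube)

Support file of the one-cut programme (crux `NoHeavyLowerTail`, stmt-CriticalPhenomena-4575; lemma factory `prim-lf-1` gen 29; memo
`FROM-prim-lf-1-gen29-RHO-INTERPOLATION.md` §5).  Companion of `…SahiCombTriWPartialRefl` (the union-of-two-cylinders stratum `u(y) ∨ v(z)`).

Setting (a CELL of the triangle class in the language of `…SahiCombTriWGeneral`): `W = Finset γ` with a block `S ⊆ γ` (so `W = 2^S × 2^{Sᶜ}`), an index cube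
`Finset β`, a monotone family `F` of `S`-CYLINDER up-sets (membership of `e` depends only on `e ∩ S`), a monotone family `G` of `Sᶜ`-cylinder up-sets, and
`P = A ∩ B` with `A` an `S`-cylinder up-set and `B` an `Sᶜ`-cylinder up-set — in the three-cube dictionary `P = h = u × v ⊆ Y × Z`, a RECTANGLE (product of
two up-sets; the principal up-sets `↑m` of `…SahiCombTriWPrincipal` are the rectangles of principal factors).

* `FiveUpSet.card_inter_mul_card_of_cyl` — the product rule `#(C ∩ D) · #W = #C · #D` for an `S`-cylinder `C` and an `Sᶜ`-cylinder `D` (via the mixing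
  involution `(e, e') ↦ ((e ∩ S) ∪ (e' ∩ Sᶜ), (e' ∩ S) ∪ (e ∩ Sᶜ))`, local to the proof);
* `FiveUpSet.card_mul_triWTerm_rectangle` — with `a_x = #(A ∩ F x)`, `b_x = #(A ∩ refl (F x))`, `a'_x = #(B ∩ G x)`, `b'_x = #(B ∩ refl (G x))`:
  `#W · triWTerm (A ∩ B) F G x = 2 a_x a'_x − b_x a'_{xᶜ} − a_x b'_{xᶜ} − b_x b'_x + b_x b'_{xᶜ}`
  `= a_x (a'_x − a'_{xᶜ}) + (a_x − b_x)(a'_{xᶜ} − b'_{xᶜ}) + (a_x a'_x − b_x b'_x)` (pointwise identity);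
* `FiveUpSet.sum_card_mul_card_compl_le` — the "functional Kleitman" `Σ_x a_x a'_{xᶜ} ≤ Σ_x a_x a'_x` (double counting through the index profiles
  `idxSet` of `…TriWShell` + `card_inter_refl_le`);
* **`FiveUpSet.triW_nonneg_of_rectangle`** — `0 ≤ triW (A ∩ B) F G`: the three summands are `≥ 0` by the functional Kleitman inequality, by Kleitman's
  lemma `b ≤ a`, `b' ≤ a'` inside the up-sets `A`, `B`, and by `b b' ≤ a a'`.  In the cell dictionary: **`TRI(a,b,c)(f,g,h) ≥ 0` for all `a, b, c` and all
  increasing `f, g` whenever `h(y,z) = u(y) ∧ v(z)`** (and, by the `S₃`-symmetry of cells, whenever any one member is a product of up-sets of its two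
  blocks) — a stratum of `FiveUpSet.TriWIneq` on cells by a condition on one member, containing the principal stratum.
HONEST LABEL: an elementary identity + three Kleitman estimates; `TriWIneq` (a ≥ 2, general `P`) remains OPEN. [this work]
-/

namespace Summit.CriticalPhenomena.PercolationContinuityZ3.Theorems

namespace FiveUpSet

open Finset

variable {β γ : Type} [DecidableEq β] [Fintype β] [DecidableEq γ] [Fintype γ]

/-! ### Cylinders: closure properties -/

/-- The antipodal image of a `T`-cylinder is a `T`-cylinder. [this work] -/
theorem refl_cyl {T : Finset γ} {A : Finset (Finset γ)} (hA : ∀ e e', e ∩ T = e' ∩ T → (e ∈ A ↔ e' ∈ A)) :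
    ∀ e e' : Finset γ, e ∩ T = e' ∩ T → (e ∈ refl A ↔ e' ∈ refl A) := by
  intro e e' h
  rw [mem_refl, mem_refl]
  apply hA
  ext i
  have hi : i ∈ e ∩ T ↔ i ∈ e' ∩ T := by rw [h]
  simp only [mem_inter, mem_compl] at hi ⊢
  tauto

omit [Fintype γ] in
/-- The intersection of two `T`-cylinders is a `T`-cylinder. [this work] -/
theorem inter_cyl {T : Finset γ} {A C : Finset (Finset γ)} (hA : ∀ e e', e ∩ T = e' ∩ T → (e ∈ A ↔ e' ∈ A))
    (hC : ∀ e e', e ∩ T = e' ∩ T → (e ∈ C ↔ e' ∈ C)) :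
    ∀ e e' : Finset γ, e ∩ T = e' ∩ T → (e ∈ A ∩ C ↔ e' ∈ A ∩ C) := by
  intro e e' h
  rw [mem_inter, mem_inter, hA e e' h, hC e e' h]

/-! ### The product rule for complementary cylinders -/

/-- **Product rule for complementary cylinders** (uniform measure: cylinder events on disjoint blocks are independent, counting form):
for an `S`-cylinder `C` and an `Sᶜ`-cylinder `D`, `#(C ∩ D) · #(Finset γ) = #C · #D`. [this work] -/
theorem card_inter_mul_card_of_cyl (S : Finset γ) (C D : Finset (Finset γ))
    (hC : ∀ e e', e ∩ S = e' ∩ S → (e ∈ C ↔ e' ∈ C)) (hD : ∀ e e', e ∩ Sᶜ = e' ∩ Sᶜ → (e ∈ D ↔ e' ∈ D)) :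
    (C ∩ D).card * Fintype.card (Finset γ) = C.card * D.card := by
  -- the mixing involution: exchange the `Sᶜ`-parts of a pair
  set μ : Finset γ × Finset γ → Finset γ × Finset γ :=
    fun p => ((p.1 ∩ S) ∪ (p.2 ∩ Sᶜ), (p.2 ∩ S) ∪ (p.1 ∩ Sᶜ)) with hμ
  have m1 : ∀ p, (μ p).1 ∩ S = p.1 ∩ S := fun p => by
    ext i; simp only [hμ, mem_inter, mem_union, mem_compl]; tauto
  have m2 : ∀ p, (μ p).1 ∩ Sᶜ = p.2 ∩ Sᶜ := fun p => by
    ext i; simp only [hμ, mem_inter, mem_union, mem_compl]; tauto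
  have m3 : ∀ p, (μ p).2 ∩ Sᶜ = p.1 ∩ Sᶜ := fun p => by
    ext i; simp only [hμ, mem_inter, mem_union, mem_compl]; tauto
  have mm : ∀ p, μ (μ p) = p := fun p => by
    ext i
    · simp only [hμ, mem_inter, mem_union, mem_compl]; tauto
    · simp only [hμ, mem_inter, mem_union, mem_compl]; tauto
  have hinj : Function.Injective μ := Function.LeftInverse.injective mm
  have h1 : ∀ p ∈ (C ∩ D) ×ˢ (univ : Finset (Finset γ)), μ p ∈ C ×ˢ D := by
    intro p hp
    rw [mem_product] at hp ⊢
    obtain ⟨hp1, -⟩ := hp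
    rw [mem_inter] at hp1
    exact ⟨(hC _ _ (m1 p)).2 hp1.1, (hD _ _ (m3 p)).2 hp1.2⟩
  have h2 : ∀ p ∈ C ×ˢ D, μ p ∈ (C ∩ D) ×ˢ (univ : Finset (Finset γ)) := by
    intro p hp
    rw [mem_product] at hp ⊢
    exact ⟨mem_inter.2 ⟨(hC _ _ (m1 p)).2 hp.1, (hD _ _ (m2 p)).2 hp.2⟩, mem_univ _⟩
  apply le_antisymm
  · calc (C ∩ D).card * Fintype.card (Finset γ) = ((C ∩ D) ×ˢ (univ : Finset (Finset γ))).card := by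
          rw [card_product, card_univ]
      _ ≤ (C ×ˢ D).card := card_le_card_of_injOn μ h1 hinj.injOn
      _ = C.card * D.card := card_product _ _
  · calc C.card * D.card = (C ×ˢ D).card := (card_product _ _).symm
      _ ≤ ((C ∩ D) ×ˢ (univ : Finset (Finset γ))).card := card_le_card_of_injOn μ h2 hinj.injOn
      _ = (C ∩ D).card * Fintype.card (Finset γ) := by rw [card_product, card_univ]

/-- Integer form of the product rule, for a rectangle `A ∩ B` met with two more cylinders:
`#W · #(A ∩ B ∩ X ∩ Y) = #(A ∩ X) · #(B ∩ Y)` for `S`-cylinders `A, X` and `Sᶜ`-cylinders `B, Y`. [this work] -/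
theorem card_rect_inter (S : Finset γ) {A B X Y : Finset (Finset γ)}
    (hA : ∀ e e', e ∩ S = e' ∩ S → (e ∈ A ↔ e' ∈ A)) (hB : ∀ e e', e ∩ Sᶜ = e' ∩ Sᶜ → (e ∈ B ↔ e' ∈ B))
    (hX : ∀ e e', e ∩ S = e' ∩ S → (e ∈ X ↔ e' ∈ X)) (hY : ∀ e e', e ∩ Sᶜ = e' ∩ Sᶜ → (e ∈ Y ↔ e' ∈ Y)) :
    (Fintype.card (Finset γ) : ℤ) * ((A ∩ B ∩ X ∩ Y).card : ℤ) = ((A ∩ X).card : ℤ) * ((B ∩ Y).card : ℤ) := by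
  have hset : A ∩ B ∩ X ∩ Y = (A ∩ X) ∩ (B ∩ Y) := by
    ext e; simp only [mem_inter]; tauto
  have h := card_inter_mul_card_of_cyl S (A ∩ X) (B ∩ Y) (inter_cyl hA hX) (inter_cyl hB hY)
  rw [hset]
  have h' : ((A ∩ X ∩ (B ∩ Y)).card : ℤ) * (Fintype.card (Finset γ) : ℤ) = ((A ∩ X).card : ℤ) * ((B ∩ Y).card : ℤ) := by
    exact_mod_cast h
  rw [mul_comm]
  exact h'

/-! ### The pointwise identity -/

/-- **`#W · triWTerm` on a rectangle, and its three-positive-pieces form.**  With `a = #(A ∩ F x)`, `b = #(A ∩ refl (F x))`, `a' y = #(B ∩ G y)`,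
`b' y = #(B ∩ refl (G y))`:  `#W · triWTerm (A ∩ B) F G x = a (a' x − a' xᶜ) + (a − b)(a' xᶜ − b' xᶜ) + (a·a' x − b·b' x)`. [this work] -/
theorem card_mul_triWTerm_rectangle (S : Finset γ) (A B : Finset (Finset γ)) (F G : Finset β → Finset (Finset γ))
    (hA : ∀ e e', e ∩ S = e' ∩ S → (e ∈ A ↔ e' ∈ A)) (hB : ∀ e e', e ∩ Sᶜ = e' ∩ Sᶜ → (e ∈ B ↔ e' ∈ B))
    (hF : ∀ x e e', e ∩ S = e' ∩ S → (e ∈ F x ↔ e' ∈ F x)) (hG : ∀ x e e', e ∩ Sᶜ = e' ∩ Sᶜ → (e ∈ G x ↔ e' ∈ G x)) (x : Finset β) :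
    (Fintype.card (Finset γ) : ℤ) * triWTerm (A ∩ B) F G x
      = ((A ∩ F x).card : ℤ) * (((B ∩ G x).card : ℤ) - (B ∩ G xᶜ).card)
        + (((A ∩ F x).card : ℤ) - (A ∩ refl (F x)).card) * (((B ∩ G xᶜ).card : ℤ) - (B ∩ refl (G xᶜ)).card)
        + (((A ∩ F x).card : ℤ) * (B ∩ G x).card - ((A ∩ refl (F x)).card : ℤ) * (B ∩ refl (G x)).card) := by
  have t1 := card_rect_inter S hA hB (hF x) (hG x)
  have t2 := card_rect_inter S hA hB (refl_cyl (hF x)) (hG xᶜ)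
  have t3 := card_rect_inter S hA hB (hF x) (refl_cyl (hG xᶜ))
  have t4 := card_rect_inter S hA hB (refl_cyl (hF x)) (refl_cyl (hG x))
  have t5 := card_rect_inter S hA hB (refl_cyl (hF x)) (refl_cyl (hG xᶜ))
  unfold triWTerm
  linear_combination 2 * t1 - t2 - t3 - t4 + t5

/-! ### The functional Kleitman inequality by double counting -/

omit [Fintype γ] in
/-- Double counting: `Σ_x #(A ∩ F x) · #(B ∩ G x) = Σ_{e ∈ A} Σ_{e' ∈ B} #(α_e ∩ β_{e'})` with the index profiles `α_e = idxSet F e`. [this work] -/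
theorem sum_card_mul_card_eq (A B : Finset (Finset γ)) (F G : Finset β → Finset (Finset γ)) :
    ∑ x : Finset β, ((A ∩ F x).card : ℤ) * ((B ∩ G x).card : ℤ)
      = ∑ e ∈ A, ∑ e' ∈ B, ((idxSet F e ∩ idxSet G e').card : ℤ) := by
  have hA : ∀ x, ((A ∩ F x).card : ℤ) = ∑ e ∈ A, (if e ∈ F x then (1 : ℤ) else 0) := by
    intro x; rw [Finset.sum_boole, Finset.filter_mem_eq_inter]
  have hB : ∀ x, ((B ∩ G x).card : ℤ) = ∑ e' ∈ B, (if e' ∈ G x then (1 : ℤ) else 0) := by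
    intro x; rw [Finset.sum_boole, Finset.filter_mem_eq_inter]
  have hI : ∀ e e', ((idxSet F e ∩ idxSet G e').card : ℤ)
      = ∑ x : Finset β, (if e ∈ F x then (1 : ℤ) else 0) * (if e' ∈ G x then (1 : ℤ) else 0) := by
    intro e e'
    have h1 : ∀ x : Finset β, (if e ∈ F x then (1 : ℤ) else 0) * (if e' ∈ G x then (1 : ℤ) else 0)
        = if (e ∈ F x ∧ e' ∈ G x) then (1 : ℤ) else 0 := by
      intro x; by_cases h : e ∈ F x <;> by_cases h' : e' ∈ G x <;> simp [h, h']
    simp only [h1]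
    rw [Finset.sum_boole]
    have hT : (Finset.univ.filter fun x => e ∈ F x ∧ e' ∈ G x) = idxSet F e ∩ idxSet G e' := by
      ext x; simp [idxSet]
    rw [hT]
  simp only [hA, hB, hI, Finset.sum_mul_sum]
  rw [Finset.sum_comm]
  refine Finset.sum_congr rfl fun e _ => ?_
  rw [Finset.sum_comm]

omit [Fintype γ] in
/-- Double counting with the second family reflected in the index: `Σ_x #(A ∩ F x) · #(B ∩ G xᶜ) = Σ_{e ∈ A} Σ_{e' ∈ B} #(α_e ∩ refl β_{e'})`. [this work] -/
theorem sum_card_mul_card_compl_eq (A B : Finset (Finset γ)) (F G : Finset β → Finset (Finset γ)) :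
    ∑ x : Finset β, ((A ∩ F x).card : ℤ) * ((B ∩ G xᶜ).card : ℤ)
      = ∑ e ∈ A, ∑ e' ∈ B, ((idxSet F e ∩ refl (idxSet G e')).card : ℤ) := by
  have hA : ∀ x, ((A ∩ F x).card : ℤ) = ∑ e ∈ A, (if e ∈ F x then (1 : ℤ) else 0) := by
    intro x; rw [Finset.sum_boole, Finset.filter_mem_eq_inter]
  have hB : ∀ x : Finset β, ((B ∩ G xᶜ).card : ℤ) = ∑ e' ∈ B, (if e' ∈ G xᶜ then (1 : ℤ) else 0) := by
    intro x; rw [Finset.sum_boole, Finset.filter_mem_eq_inter]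
  have hI : ∀ e e', ((idxSet F e ∩ refl (idxSet G e')).card : ℤ)
      = ∑ x : Finset β, (if e ∈ F x then (1 : ℤ) else 0) * (if e' ∈ G xᶜ then (1 : ℤ) else 0) := by
    intro e e'
    have h1 : ∀ x : Finset β, (if e ∈ F x then (1 : ℤ) else 0) * (if e' ∈ G xᶜ then (1 : ℤ) else 0)
        = if (e ∈ F x ∧ e' ∈ G xᶜ) then (1 : ℤ) else 0 := by
      intro x; by_cases h : e ∈ F x <;> by_cases h' : e' ∈ G xᶜ <;> simp [h, h']
    simp only [h1]
    rw [Finset.sum_boole]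
    have hT : (Finset.univ.filter fun x : Finset β => e ∈ F x ∧ e' ∈ G xᶜ) = idxSet F e ∩ refl (idxSet G e') := by
      ext x; simp [idxSet, mem_refl]
    rw [hT]
  simp only [hA, hB, hI, Finset.sum_mul_sum]
  rw [Finset.sum_comm]
  refine Finset.sum_congr rfl fun e _ => ?_
  rw [Finset.sum_comm]

omit [Fintype γ] in
/-- **Functional Kleitman inequality** for the profiles `a_x = #(A ∩ F x)`, `a'_x = #(B ∩ G x)` of monotone families (any `A, B`):
`Σ_x a_x a'_{xᶜ} ≤ Σ_x a_x a'_x` (Kleitman's lemma `card_inter_refl_le` in the index cube, through the index profiles). [this work] -/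
theorem sum_card_mul_card_compl_le (A B : Finset (Finset γ)) {F G : Finset β → Finset (Finset γ)}
    (hFm : Monotone F) (hGm : Monotone G) :
    ∑ x : Finset β, ((A ∩ F x).card : ℤ) * ((B ∩ G xᶜ).card : ℤ)
      ≤ ∑ x : Finset β, ((A ∩ F x).card : ℤ) * ((B ∩ G x).card : ℤ) := by
  rw [sum_card_mul_card_compl_eq A B F G, sum_card_mul_card_eq A B F G]
  refine Finset.sum_le_sum fun e _ => Finset.sum_le_sum fun e' _ => ?_
  exact_mod_cast card_inter_refl_le (isUpperSet_idxSet hFm e) (isUpperSet_idxSet hGm e')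

/-! ### The rectangle stratum -/

/-- **`TRI_W(a) ≥ 0` on every cell when `P` is a rectangle.**  Let `S ⊆ γ` be a block, `F` a monotone family of `S`-cylinder up-sets and `G` a monotone
family of `Sᶜ`-cylinder up-sets over any index cube `Finset β`, and `P = A ∩ B` with `A` an `S`-cylinder up-set and `B` an `Sᶜ`-cylinder up-set
(`h(y,z) = u(y) ∧ v(z)` in the cell dictionary).  Then `0 ≤ triW (A ∩ B) F G`.  Proof: `#W · triW = Σ_x [a_x(a'_x − a'_{xᶜ}) + (a_x − b_x)(a'_{xᶜ} − b'_{xᶜ})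
+ (a_x a'_x − b_x b'_x)]` (`card_mul_triWTerm_rectangle`); the first sum is `≥ 0` by `sum_card_mul_card_compl_le`, and `b ≤ a`, `b' ≤ a'` by Kleitman's lemma
inside `A` and `B`. [this work] -/
theorem triW_nonneg_of_rectangle (S : Finset γ) (A B : Finset (Finset γ)) (F G : Finset β → Finset (Finset γ))
    (hA : ∀ e e', e ∩ S = e' ∩ S → (e ∈ A ↔ e' ∈ A)) (hB : ∀ e e', e ∩ Sᶜ = e' ∩ Sᶜ → (e ∈ B ↔ e' ∈ B))
    (hAu : IsUpperSet (A : Set (Finset γ))) (hBu : IsUpperSet (B : Set (Finset γ)))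
    (hFc : ∀ x e e', e ∩ S = e' ∩ S → (e ∈ F x ↔ e' ∈ F x)) (hGc : ∀ x e e', e ∩ Sᶜ = e' ∩ Sᶜ → (e ∈ G x ↔ e' ∈ G x))
    (hF : ∀ x, IsUpperSet (F x : Set (Finset γ))) (hG : ∀ x, IsUpperSet (G x : Set (Finset γ)))
    (hFm : Monotone F) (hGm : Monotone G) : 0 ≤ triW (A ∩ B) F G := by
  have hN : (0 : ℤ) < (Fintype.card (Finset γ) : ℤ) := by exact_mod_cast Fintype.card_pos
  have key : (Fintype.card (Finset γ) : ℤ) * triW (A ∩ B) F G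
      = ∑ x : Finset β, (((A ∩ F x).card : ℤ) * (((B ∩ G x).card : ℤ) - (B ∩ G xᶜ).card)
        + (((A ∩ F x).card : ℤ) - (A ∩ refl (F x)).card) * (((B ∩ G xᶜ).card : ℤ) - (B ∩ refl (G xᶜ)).card)
        + (((A ∩ F x).card : ℤ) * (B ∩ G x).card - ((A ∩ refl (F x)).card : ℤ) * (B ∩ refl (G x)).card)) := by
    unfold triW
    rw [Finset.mul_sum]
    exact Finset.sum_congr rfl fun x _ => card_mul_triWTerm_rectangle S A B F G hA hB hFc hGc x
  have hab : ∀ x : Finset β, ((A ∩ refl (F x)).card : ℤ) ≤ (A ∩ F x).card := fun x => by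
    exact_mod_cast card_inter_refl_le hAu (hF x)
  have hab' : ∀ x : Finset β, ((B ∩ refl (G x)).card : ℤ) ≤ (B ∩ G x).card := fun x => by
    exact_mod_cast card_inter_refl_le hBu (hG x)
  have h1 : 0 ≤ ∑ x : Finset β, ((A ∩ F x).card : ℤ) * (((B ∩ G x).card : ℤ) - (B ∩ G xᶜ).card) := by
    have h := sum_card_mul_card_compl_le A B hFm hGm
    have e : ∑ x : Finset β, ((A ∩ F x).card : ℤ) * (((B ∩ G x).card : ℤ) - (B ∩ G xᶜ).card)
        = ∑ x : Finset β, ((A ∩ F x).card : ℤ) * ((B ∩ G x).card : ℤ)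
          - ∑ x : Finset β, ((A ∩ F x).card : ℤ) * ((B ∩ G xᶜ).card : ℤ) := by
      rw [← Finset.sum_sub_distrib]
      exact Finset.sum_congr rfl fun x _ => by ring
    rw [e]; linarith
  have h2 : 0 ≤ ∑ x : Finset β, (((A ∩ F x).card : ℤ) - (A ∩ refl (F x)).card) * (((B ∩ G xᶜ).card : ℤ) - (B ∩ refl (G xᶜ)).card) :=
    Finset.sum_nonneg fun x _ => mul_nonneg (sub_nonneg.2 (hab x)) (sub_nonneg.2 (hab' xᶜ))
  have h3 : 0 ≤ ∑ x : Finset β, (((A ∩ F x).card : ℤ) * (B ∩ G x).card - ((A ∩ refl (F x)).card : ℤ) * (B ∩ refl (G x)).card) := by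
    refine Finset.sum_nonneg fun x _ => sub_nonneg.2 ?_
    exact mul_le_mul (hab x) (hab' x) (by positivity) (by positivity)
  have htot : 0 ≤ (Fintype.card (Finset γ) : ℤ) * triW (A ∩ B) F G := by
    rw [key, Finset.sum_add_distrib, Finset.sum_add_distrib]
    exact add_nonneg (add_nonneg h1 h2) h3
  exact le_of_mul_le_mul_left (by rw [mul_zero]; exact htot) hN

end FiveUpSet

end Summit.CriticalPhenomena.PercolationContinuityZ3.Theorems
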